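import Summits.FinalStateConjecture.FinalStateConjecture.Theorems.StarvedNecksNecksCertifyStubSeamSurgeryHelpers
import Literature.Geometry.Lorentzian.KerrSchildCoord
import Literature.Geometry.Lorentzian.KerrSchildDivergence

/-!
# Route StarvedNecks — crux `NecksCertify`, line `two-cap-focusing-ledger`: seam surgery, oblate scaling

Helper file for the registered stub `stub_seamSurgery` (N2): the OBLATE SCALING underlying the
radial squash of the far hole leaves, in rest-frame Kerr–Schild coordinates `x = (t, x̄) ∈ E4` of
one hole with spin `a` (registered helper sub-goal `stub_seamSurgery_oblateScaling`): the map
`P x ρ = (x⁰, λx₁, λx₂, μx₃)`, `λ = √(ρ² + a²)/√(r² + a²)`, `μ = ρ/r`, `r = r_a(x)`, moves a point of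
Kerr–Schild radius `r > 0` to radius `ρ > 0` along its confocal-ellipsoid coordinates
(`Kerr.radius_eq_of_pos_of_quartic`); `P x r = x`, `P (P x ρ) ρ' = P x ρ'`, `P` commutes with
time translations, is injective at fixed radii, and `x ↦ P x (h x)` is `C^∞` (continuous) for
`C^∞` (continuous) positive `h` where `r > 0`.  Plus the continuity of the inverse of a strictly
increasing real function onto a half-line (`continuousOn_invFun_of_strictMono`).

Mathlib + `Literature.Geometry.Lorentzian.{KerrSchild, KerrSchildCoord, KerrSchildDivergence}` +
the landed seam helper module; no definitions, no named facts.
-/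

noncomputable section

open scoped Topology ContDiff
open Filter Set Function Literature.Geometry.Lorentzian

namespace Summit.FinalStateConjecture.FinalStateConjecture.Theorems.NecksCertifyTwoCap.Seam

set_option linter.dupNamespace false

open Summit.FinalStateConjecture.FinalStateConjecture.Theorems.NecksCertifyBargmann.Seam
  (kerr_radius_add_smul_basisVector_zero eq_add_lorentz_poincareInv)

/-! ## The oblate scaling -/

/-- **Oblate scaling** (registered helper sub-goal `stub_seamSurgery_oblateScaling` of N2).  In Kerr–Schild coordinates with spin `a` there is a map
`P : E4 → ℝ → E4` (explicitly `P x ρ = (x⁰, λx₁, λx₂, μx₃)`, `λ = √(ρ² + a²)/√(r² + a²)`,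
`μ = ρ/r`, `r = r_a(x)`) such that, for `r_a(x) > 0` and `ρ, ρ' > 0`: the time coordinate is
unchanged, `r_a (P x ρ) = ρ` (the image lies on the confocal ellipsoid
`(x₁² + x₂²)/(ρ² + a²) + x₃²/ρ² = 1`, Visser arXiv:0706.0622, (35)), `P x (r_a x) = x`,
`P (P x ρ) ρ' = P x ρ'`, `P` commutes with time translations, and `x ↦ P x (h x)` is `C^∞` on
any open set where `r_a > 0` and `h > 0` is `C^∞`. [folklore] -/
theorem stub_seamSurgery_oblateScaling :
    ∀ (a : ℝ), ∃ P : E4 → ℝ → E4,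
      (∀ x ρ, P x ρ 0 = x 0) ∧
      (∀ x ρ, 0 < Kerr.radius a x → 0 < ρ → Kerr.radius a (P x ρ) = ρ) ∧
      (∀ x, 0 < Kerr.radius a x → P x (Kerr.radius a x) = x) ∧
      (∀ x ρ ρ', 0 < Kerr.radius a x → 0 < ρ → 0 < ρ' → P (P x ρ) ρ' = P x ρ') ∧
      (∀ x ρ (u : ℝ), P (x + u • E4.basisVector 0) ρ = P x ρ + u • E4.basisVector 0) ∧
      (∀ (V : Set E4) (h : E4 → ℝ), IsOpen V → (∀ x ∈ V, 0 < Kerr.radius a x) →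
        (∀ x ∈ V, 0 < h x) → ContDiffOn ℝ ∞ h V → ContDiffOn ℝ ∞ (fun x ↦ P x (h x)) V) ∧
      (∀ x x' ρ, 0 < Kerr.radius a x → Kerr.radius a x' = Kerr.radius a x → 0 < ρ →
        P x ρ = P x' ρ → x = x') ∧
      (∀ (V : Set E4) (h : E4 → ℝ), (∀ x ∈ V, 0 < Kerr.radius a x) → ContinuousOn h V →
        ContinuousOn (fun x ↦ P x (h x)) V) := by
  intro a
  set P : E4 → ℝ → E4 := fun x ρ ↦ WithLp.toLp 2
    ![x 0, (√(ρ ^ 2 + a ^ 2) / √(Kerr.radius a x ^ 2 + a ^ 2)) * x 1,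
      (√(ρ ^ 2 + a ^ 2) / √(Kerr.radius a x ^ 2 + a ^ 2)) * x 2, (ρ / Kerr.radius a x) * x 3]
    with hP
  have hP0 : ∀ x ρ, P x ρ 0 = x 0 := fun x ρ ↦ by simp [hP]
  have hP1 : ∀ x ρ, P x ρ 1 = (√(ρ ^ 2 + a ^ 2) / √(Kerr.radius a x ^ 2 + a ^ 2)) * x 1 :=
    fun x ρ ↦ by simp [hP]
  have hP2 : ∀ x ρ, P x ρ 2 = (√(ρ ^ 2 + a ^ 2) / √(Kerr.radius a x ^ 2 + a ^ 2)) * x 2 :=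
    fun x ρ ↦ by simp [hP]
  have hP3 : ∀ x ρ, P x ρ 3 = (ρ / Kerr.radius a x) * x 3 := fun x ρ ↦ by simp [hP]
  -- the radius of the scaled point
  have hrad : ∀ x ρ, 0 < Kerr.radius a x → 0 < ρ → Kerr.radius a (P x ρ) = ρ := by
    intro x ρ hr hρ
    set r := Kerr.radius a x with hrdef
    have hq := Kerr.radius_quartic a x
    rw [← hrdef, E4.spatialNorm_sq] at hq
    have hra : 0 < r ^ 2 + a ^ 2 := by positivity
    have hρa : 0 < ρ ^ 2 + a ^ 2 := by positivity
    have hL : (√(ρ ^ 2 + a ^ 2) / √(r ^ 2 + a ^ 2)) ^ 2 = (ρ ^ 2 + a ^ 2) / (r ^ 2 + a ^ 2) := by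
      rw [div_pow, Real.sq_sqrt hρa.le, Real.sq_sqrt hra.le]
    refine Kerr.radius_eq_of_pos_of_quartic hρ ?_
    rw [E4.spatialNorm_sq, hP1, hP2, hP3, ← hrdef]
    have key : (x 1 ^ 2 + x 2 ^ 2) * r ^ 2 + x 3 ^ 2 * (r ^ 2 + a ^ 2) = r ^ 2 * (r ^ 2 + a ^ 2) := by
      nlinarith [hq]
    have e1 : ((√(ρ ^ 2 + a ^ 2) / √(r ^ 2 + a ^ 2)) * x 1) ^ 2 +
        ((√(ρ ^ 2 + a ^ 2) / √(r ^ 2 + a ^ 2)) * x 2) ^ 2 =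
        (ρ ^ 2 + a ^ 2) / (r ^ 2 + a ^ 2) * (x 1 ^ 2 + x 2 ^ 2) := by
      rw [mul_pow, mul_pow, hL]; ring
    have hr0 : r ≠ 0 := hr.ne'
    rw [e1]
    field_simp
    linear_combination (-(ρ ^ 2) * (ρ ^ 2 + a ^ 2)) * key
  refine ⟨P, hP0, hrad, ?_, ?_, ?_, ?_, ?_, ?_⟩
  · -- `P x r = x`
    intro x hr
    have h1 : √(Kerr.radius a x ^ 2 + a ^ 2) / √(Kerr.radius a x ^ 2 + a ^ 2) = 1 :=
      div_self (Real.sqrt_pos.mpr (by positivity)).ne'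
    have h2 : Kerr.radius a x / Kerr.radius a x = 1 := div_self hr.ne'
    ext i
    fin_cases i
    · simp [hP]
    · simp [hP, h1]
    · simp [hP, h1]
    · simp [hP, h2]
  · -- composition
    intro x ρ ρ' hr hρ hρ'
    have hrr := hrad x ρ hr hρ
    have hs : √(ρ ^ 2 + a ^ 2) ≠ 0 := (Real.sqrt_pos.mpr (by positivity)).ne'
    have hs' : √(Kerr.radius a x ^ 2 + a ^ 2) ≠ 0 := (Real.sqrt_pos.mpr (by positivity)).ne'
    have hr0 : Kerr.radius a x ≠ 0 := hr.ne'
    have hρ0 : ρ ≠ 0 := hρ.ne'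
    ext i
    fin_cases i
    · show P (P x ρ) ρ' 0 = P x ρ' 0
      rw [hP0, hP0, hP0]
    · show P (P x ρ) ρ' 1 = P x ρ' 1
      rw [hP1, hP1, hP1, hrr]
      field_simp
    · show P (P x ρ) ρ' 2 = P x ρ' 2
      rw [hP2, hP2, hP2, hrr]
      field_simp
    · show P (P x ρ) ρ' 3 = P x ρ' 3
      rw [hP3, hP3, hP3, hrr]
      field_simp
  · -- time translations
    intro x ρ u
    have hr : Kerr.radius a (x + u • E4.basisVector 0) = Kerr.radius a x :=
      kerr_radius_add_smul_basisVector_zero a u x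
    ext i
    fin_cases i <;> simp [hP, hr, E4.basisVector]
  · -- smoothness
    intro V h hV hr hh hcd
    rw [contDiffOn_piLp]
    intro i
    have hrad_cd : ContDiffOn ℝ ∞ (Kerr.radius a) V := fun x hx ↦
      (Kerr.contDiffAt_radius (hr x hx)).contDiffWithinAt
    have hc : ∀ j : Fin 4, ContDiffOn ℝ ∞ (fun x : E4 ↦ x j) V := fun j ↦
      (EuclideanSpace.proj (𝕜 := ℝ) j).contDiff.contDiffOn
    have hL : ContDiffOn ℝ ∞ (fun x ↦ √(h x ^ 2 + a ^ 2) / √(Kerr.radius a x ^ 2 + a ^ 2)) V := by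
      refine ContDiffOn.div ?_ ?_ fun x hx ↦ (Real.sqrt_pos.mpr (by nlinarith [hr x hx])).ne'
      · exact (hcd.pow 2 |>.add contDiffOn_const).sqrt fun x hx ↦ by nlinarith [hh x hx]
      · exact (hrad_cd.pow 2 |>.add contDiffOn_const).sqrt fun x hx ↦ by nlinarith [hr x hx]
    have hM : ContDiffOn ℝ ∞ (fun x ↦ h x / Kerr.radius a x) V :=
      hcd.div hrad_cd fun x hx ↦ (hr x hx).ne'
    fin_cases i
    · simpa [hP] using hc 0
    · simpa [hP] using hL.mul (hc 1)
    · simpa [hP] using hL.mul (hc 2)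
    · simpa [hP] using hM.mul (hc 3)
  · -- injectivity at fixed radius and target radius
    intro x x' ρ hr hrr hρ h
    have hs : √(ρ ^ 2 + a ^ 2) / √(Kerr.radius a x ^ 2 + a ^ 2) ≠ 0 :=
      div_ne_zero (Real.sqrt_pos.mpr (by positivity)).ne' (Real.sqrt_pos.mpr (by positivity)).ne'
    have hm : ρ / Kerr.radius a x ≠ 0 := div_ne_zero hρ.ne' hr.ne'
    have e0 := congrArg (fun p : E4 ↦ p 0) h
    have e1 := congrArg (fun p : E4 ↦ p 1) h
    have e2 := congrArg (fun p : E4 ↦ p 2) h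
    have e3 := congrArg (fun p : E4 ↦ p 3) h
    simp only [hP0] at e0
    simp only [hP1, hrr] at e1
    simp only [hP2, hrr] at e2
    simp only [hP3, hrr] at e3
    ext i
    fin_cases i
    · exact e0
    · exact mul_left_cancel₀ hs e1
    · exact mul_left_cancel₀ hs e2
    · exact mul_left_cancel₀ hm e3
  · -- continuity
    intro V h hr hh
    have hrad_c : ContinuousOn (Kerr.radius a) V := (Kerr.continuous_radius a).continuousOn
    have hc : ∀ j : Fin 4, ContinuousOn (fun x : E4 ↦ x j) V := fun j ↦
      (PiLp.continuous_apply 2 _ j).continuousOn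
    have hL : ContinuousOn (fun x ↦ √(h x ^ 2 + a ^ 2) / √(Kerr.radius a x ^ 2 + a ^ 2)) V := by
      refine ContinuousOn.div ?_ ?_ fun x hx ↦ (Real.sqrt_pos.mpr (by nlinarith [hr x hx])).ne'
      · exact (hh.pow 2 |>.add continuousOn_const).sqrt
      · exact (hrad_c.pow 2 |>.add continuousOn_const).sqrt
    have hM : ContinuousOn (fun x ↦ h x / Kerr.radius a x) V :=
      hh.div hrad_c fun x hx ↦ (hr x hx).ne'
    have hpi : ContinuousOn (fun x : E4 ↦
        ![x 0, (√(h x ^ 2 + a ^ 2) / √(Kerr.radius a x ^ 2 + a ^ 2)) * x 1,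
          (√(h x ^ 2 + a ^ 2) / √(Kerr.radius a x ^ 2 + a ^ 2)) * x 2,
          (h x / Kerr.radius a x) * x 3]) V := by
      refine continuousOn_pi.mpr fun i ↦ ?_
      fin_cases i
      · simpa using hc 0
      · simpa using ContinuousOn.fun_mul hL (hc 1)
      · simpa using ContinuousOn.fun_mul hL (hc 2)
      · simpa using ContinuousOn.fun_mul hM (hc 3)
    exact (PiLp.continuous_toLp 2 _).comp_continuousOn hpi

/-! ## Inverse of a strictly increasing function -/

/-- Continuity of the inverse of a strictly increasing `g : ℝ → ℝ` on an interval `(−∞, L)` onto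
which `g` maps (elementary: `g` separates `u ± ε` from `u`). [folklore] -/
theorem continuousOn_invFun_of_strictMono (g : ℝ → ℝ) (L : ℝ) (hgm : StrictMono g)
    (hgs : ∀ y, y < L → ∃ u, g u = y) : ContinuousOn (Function.invFun g) (Iio L) := by
  have h2 : ∀ y, y < L → g (Function.invFun g y) = y := fun y hy ↦ Function.invFun_eq (hgs y hy)
  rw [Metric.continuousOn_iff]
  intro v hv ε hε
  set u := Function.invFun g v with hu
  have hgu : g u = v := h2 v hv
  refine ⟨min (g (u + ε) - v) (v - g (u - ε)), lt_min (by rw [← hgu]; linarith [hgm (show u < u + ε by linarith)])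
    (by rw [← hgu]; linarith [hgm (show u - ε < u by linarith)]), fun v' hv' hd ↦ ?_⟩
  have hgu' : g (Function.invFun g v') = v' := h2 v' hv'
  rw [Real.dist_eq, abs_lt] at hd ⊢
  have hd1 := (lt_min_iff.mp hd.2).1
  have hd3 : -(v - g (u - ε)) < v' - v := lt_of_le_of_lt (neg_le_neg (min_le_right _ _)) hd.1
  constructor
  · by_contra hle
    push Not at hle
    have : g (Function.invFun g v') ≤ g (u - ε) := hgm.monotone (by linarith)
    linarith
  · by_contra hle
    push Not at hle
    have : g (u + ε) ≤ g (Function.invFun g v') := hgm.monotone (by linarith)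
    linarith

end Summit.FinalStateConjecture.FinalStateConjecture.Theorems.NecksCertifyTwoCap.Seam

end
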